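import Summits.HodgeConjecture.CorCM.CMAbelianFourfoldPowers
import Summits.HodgeConjecture.CorCM.TwoSimpleCMSurfacesHodge
import Summits.HodgeConjecture.CorCM.MumfordTateRankOfCMAbelianVariety
import Summits.HodgeConjecture.CorCM.MumfordTateRankEllipticProducts
import Summits.HodgeConjecture.CorCM.MumfordTateRankTimesRealMultiplicationCells
import Summits.HodgeConjecture.CorCM.MumfordTateRankSimpleSurfacesSharp
import Summits.HodgeConjecture.CorCM.MumfordTateRankOfPowers
import HarnessLib

/-!
# The fourfold partition `{2, 2}`: `t(S × S′) + 1 = t(S) + t(S′)` for every pair of NON-ISOGENOUS simple abelian surfaces, `t(S × S′) = t(S)`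
# for isogenous ones — in particular two non-isogenous simple CM surfaces: `t = 5` — and the table `t(S × S′) ∈ {3, 4, 5, 6, 7, 9, 10, 11, 13, 14, 17, 21}`

COR-CM (cell `pub-hodgecm2`, seat `b27` gen 49, count-neutral Mumford–Tate-rank ladder; theorems only, no definition, no named fact;
UNCONDITIONAL — nothing here uses or asserts HC_CM).  Notation `t(X) = dim MT(H¹X)`.

Moonen–Zarhin Thm. (0.1) (4) and §5 (5.5): a product of two simple abelian surfaces is never in the exceptional cases (a)–(d), so
`Hg(S × S′) = Hg(S) × Hg(S′)` for `S ≁ S′`.  The cells with a non-CM factor are gen 47's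
`mtRank_hodge_one_add_one_eq_add_of_isIsogenous_prod_simpleSurfaces_of_not_isOfCMType` (Lemma (3.4) for `hodgeLie`); the CM × CM cell is
seat b16's `isNondegenerateFamily_simpleSurfaces` («any two simple, non-isogenous CM abelian surfaces form a nondegenerate pair», all field
configurations) transported to abstract `S`, `S′` by Milne's regrouping as in `CorCM/MumfordTateRankCMSurfaceTimesCMThreefold`.

* **`mtRank_hodge_one_eq_five_of_isIsogenous_prod_cmSurfaces_of_not_isIsogenous`** — `S`, `S′` simple CM surfaces, `S ≁ S′`: `t(S × S′) = 5`.
* **`mtRank_hodge_one_of_isIsogenous_prod_simpleSurfaces`** — for every `X ∼ S × S′` with `S`, `S′` simple surfaces: `t(X) = t(S)` if `S ∼ S′`,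
  `t(X) + 1 = t(S) + t(S′)` if not.
* **`mtRank_hodge_one_mem_of_isIsogenous_prod_simpleSurfaces`** — `t(X) ∈ {3, 4, 5, 6, 7, 9, 10, 11, 13, 14, 17, 21}` (`t(S), t(S′) ∈ {3, 4, 7, 11}`).

## References
* [MoonenZarhin1999LowDim] B. Moonen, Yu. G. Zarhin, *Hodge classes on abelian varieties of low dimension*, Math. Ann. 315 (1999), Thm. (0.1) (4),
  §2 (2.2), §3 Lemma (3.4), §5 (5.5) and «Hodge groups of simple abelian surfaces of CM-type» [corpus: paper:arxiv-math_9901113 pp. 1–2, 5–9].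
  [cite: MoonenZarhin1999LowDim, Thm. (0.1) (4) and §5 (5.5)]
* [Gordon1999HodgeAVSurvey] B. B. Gordon, *A survey of the Hodge conjecture for abelian varieties*, 7.5–7.7, 9.1. [cite: Gordon1999HodgeAVSurvey, 7.5 and 9.1]
* [MumfordAV1970] D. Mumford, *Abelian Varieties* (1970), §19 Thm. 1, Cor. 1–2. [cite: MumfordAV1970, §19 Cor. 1 of Thm. 1]
-/

noncomputable section

open CategoryTheory CategoryTheory.Limits NumberField Module
open scoped BigOperators

namespace Summit.HodgeConjecture.CorCM

open Literature.NumberTheory.ComplexMultiplication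
open Literature.AlgebraicGeometry.Motives
open Literature.AlgebraicGeometry.Motives.AbelianVariety
open Literature.AlgebraicGeometry.HodgeTheory
open Literature.AlgebraicGeometry.ComplexMultiplication (IsCMTypeRealisation)
open Literature.AlgebraicGeometry.Milne1999
open Literature.AlgebraicGeometry.Pohlmann1968
open Summit.HodgeConjecture.CorCM.Domination

variable [HodgeTensorFacts.{0, 0}] {X : AbelianVariety ℂ} {n : ℕ}

/-! ## §1 Two non-isogenous simple CM surfaces: `t = 5` -/

/-- **Two NON-ISOGENOUS simple CM abelian surfaces: `t(S × S′) = 5`** (`Hg(S × S′) = U_{F} × U_{F′}`, both of rank `2`; whatever the quartic CM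
fields).  Milne's regrouping of `X ∼ S × S′` has exactly the two slots `∼ S`, `∼ S′`; seat b16's `isNondegenerateFamily_simpleSurfaces` and
`isNondegenerateFamily_iff_mtRank_hodge_one_eq`. [cite: MoonenZarhin1999LowDim, Thm. (0.1) (4) and §5 (5.5)] [cite: Gordon1999HodgeAVSurvey, 7.5 and 9.1] -/
theorem mtRank_hodge_one_eq_five_of_isIsogenous_prod_cmSurfaces_of_not_isIsogenous (hX : IsSmoothProjective n X.X) {S S' : AbelianVariety ℂ}
    (hSs : S.IsSimple) (hS2 : S.dim = 2) (hScm : IsOfCMType S) (hS's : S'.IsSimple) (hS'2 : S'.dim = 2) (hS'cm : IsOfCMType S')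
    (hSS' : ¬ IsIsogenous S S') (hXP : IsIsogenous X (S.prod S')) :
    haveI := BettiUniverse.finite hX 1
    (BettiUniverse.hodge exists_isReal_hodgeModel_holds hX 1).mtRank = 5 := by
  classical
  haveI := BettiUniverse.finite hX 1
  obtain ⟨g, hg⟩ := hXP
  have h0 : 0 < X.dim := by rw [dim_eq_of_isIsogeny hg, dim_prod]; omega
  have hcm : IsOfCMType X := (isOfCMType_iff_of_isIsogenous ⟨g, hg⟩).2 (isOfCMType_prod_iff.2 ⟨hScm, hS'cm⟩)
  obtain ⟨C, _, K', _, _, _, Φ', A', ι', θ', m, cls, f, hA, hs, hniso, hcls, hf⟩ :=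
    exists_isIsogeny_biproduct_of_isSimple_of_isOfCMType h0 hcm
  obtain ⟨g₂, hg₂⟩ := prod_isIsogenous_biproduct_two S S'
  have hF : ∀ j : Fin 2, ((![S, S'] : Fin 2 → AbelianVariety ℂ) j).IsSimple := fun j => by
    fin_cases j
    · exact hSs
    · exact hS's
  have hdom : ∀ c, AVDominatedBy (A' c) (⨁ fun j : Fin 2 => (![S, S'] : Fin 2 → AbelianVariety ℂ) j) := by
    intro c
    obtain ⟨j, rfl⟩ := hcls c
    exact ((((avDominatedBy_biproduct_summand (fun i => A' (cls i)) j).trans_isIsogeny_inv hf).trans_isIsogeny_hom hg)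
      ).trans_isIsogeny_hom hg₂
  have hdimpos : ∀ c, 0 < (A' c).dim := fun c => by
    have h := finrank_eq_two_mul_dim_of_isCMTypeRealisation (hA c)
    have hpos : 0 < finrank ℚ (K' c) := Module.finrank_pos
    omega
  have hrep : ∀ c, IsIsogenous (A' c) S ∨ IsIsogenous (A' c) S' := fun c => by
    obtain ⟨j, hj⟩ := exists_isIsogenous_of_isSimple_of_avDominatedBy_biproduct hF (hs c) (hdimpos c) (hdom c)
    fin_cases j
    · exact Or.inl hj
    · exact Or.inr hj
  have hSX : AVDominatedBy S X := (SliceExhaustion.avDominatedBy_prod_left S S').trans_isIsogeny_inv hg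
  have hS'X : AVDominatedBy S' X := (avDominatedBy_prod_right S S').trans_isIsogeny_inv hg
  obtain ⟨j₀, hj₀⟩ := exists_isIsogenous_of_isSimple_of_avDominatedBy_biproduct (fun j => hs (cls j)) hSs (by omega)
    (hSX.trans_isIsogeny_hom hf)
  obtain ⟨j₁, hj₁⟩ := exists_isIsogenous_of_isSimple_of_avDominatedBy_biproduct (fun j => hs (cls j)) hS's (by omega)
    (hS'X.trans_isIsogeny_hom hf)
  set c₀ := cls j₀ with hc₀
  set c₁ := cls j₁ with hc₁
  have hd₀ : (A' c₀).dim = 2 := by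
    obtain ⟨u, hu⟩ := hj₀
    rw [← hS2, dim_eq_of_isIsogeny hu]
  have hd₁ : (A' c₁).dim = 2 := by
    obtain ⟨u, hu⟩ := hj₁
    rw [← hS'2, dim_eq_of_isIsogeny hu]
  have h01 : c₀ ≠ c₁ := fun h => hSS' (hj₀.trans (h ▸ hj₁.symm'))
  have hI : ∀ c, c = c₀ ∨ c = c₁ := by
    intro c
    rcases hrep c with hcS | hcS'
    · left
      by_contra hne
      exact hniso c c₀ hne (hcS.trans hj₀)
    · right
      by_contra hne
      exact hniso c c₁ hne (hcS'.trans hj₁)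
  have h4 : ∀ c, finrank ℚ (K' c) = 4 := fun c => by
    rw [finrank_eq_two_mul_dim_of_isCMTypeRealisation (hA c)]
    rcases hI c with rfl | rfl
    · rw [hd₀]
    · rw [hd₁]
  haveI : Nonempty C := ⟨c₀⟩
  have hnd : CMAlgebra.IsNondegenerateFamily Φ' := isNondegenerateFamily_simpleSurfaces h01 hI h4 hA hs hniso
  have ht := (isNondegenerateFamily_iff_mtRank_hodge_one_eq hA hcls hX ⟨f, hf⟩).1 hnd
  have huniv : (Finset.univ : Finset C) = {c₀, c₁} := by
    ext c
    simp only [Finset.mem_univ, Finset.mem_insert, Finset.mem_singleton, true_iff]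
    exact hI c
  rw [ht, huniv, Finset.sum_pair h01, hd₀, hd₁]

/-! ## §2 The partition `{2, 2}` -/

/-- **For every `X ∼ S × S′` with `S`, `S′` simple abelian surfaces: `t(X) = t(S)` if `S ∼ S′`, and `t(X) + 1 = t(S) + t(S′)` if `S ≁ S′`**
(`Hg(S × S′) = Hg(S) × Hg(S′)` for non-isogenous simple surfaces — Moonen–Zarhin Thm. (0.1) (4), (5.5) —, `Hg(S × S) = Hg(S)`).
[cite: MoonenZarhin1999LowDim, Thm. (0.1) (4) and §5 (5.5)] [cite: MumfordAV1970, §19 Cor. 1 of Thm. 1] -/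
theorem mtRank_hodge_one_of_isIsogenous_prod_simpleSurfaces (hX : IsSmoothProjective n X.X) {S S' : AbelianVariety ℂ} {k l : ℕ}
    (hS : IsSmoothProjective k S.X) (hS' : IsSmoothProjective l S'.X) (hSs : S.IsSimple) (hS2 : S.dim = 2) (hS's : S'.IsSimple)
    (hS'2 : S'.dim = 2) (hXP : IsIsogenous X (S.prod S')) :
    haveI := BettiUniverse.finite hX 1
    haveI := BettiUniverse.finite hS 1
    haveI := BettiUniverse.finite hS' 1
    (IsIsogenous S S' → (BettiUniverse.hodge exists_isReal_hodgeModel_holds hX 1).mtRank = (BettiUniverse.hodge exists_isReal_hodgeModel_holds hS 1).mtRank) ∧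
      (¬ IsIsogenous S S' → (BettiUniverse.hodge exists_isReal_hodgeModel_holds hX 1).mtRank + 1 =
        (BettiUniverse.hodge exists_isReal_hodgeModel_holds hS 1).mtRank + (BettiUniverse.hodge exists_isReal_hodgeModel_holds hS' 1).mtRank) := by
  classical
  have hkS : S.dim = k := schemeDim_eq_holds hS
  have hlS : S'.dim = l := schemeDim_eq_holds hS'
  subst hkS hlS
  haveI := BettiUniverse.finite hX 1
  haveI := BettiUniverse.finite hS 1
  haveI := BettiUniverse.finite hS' 1
  refine ⟨fun hSS' => ?_, fun hSS' => ?_⟩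
  · exact mtRank_hodge_one_eq_of_isIsogenous_powSucc hX hS (by omega) (m := 1) (hXP.trans ((IsIsogenous.refl S).prod hSS'.symm'))
  · by_cases hS'cm : IsOfCMType S'
    · by_cases hScm : IsOfCMType S
      · -- both of CM type: `t = 5 = 3 + 3 − 1`
        have h5 := mtRank_hodge_one_eq_five_of_isIsogenous_prod_cmSurfaces_of_not_isIsogenous hX hSs hS2 hScm hS's hS'2 hS'cm hSS' hXP
        have h3 := (isOfCMType_iff_mtRank_hodge_one_eq_three_of_isSimple_surface hS hSs hS2).1 hScm
        have h3' := (isOfCMType_iff_mtRank_hodge_one_eq_three_of_isSimple_surface hS' hS's hS'2).1 hS'cm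
        omega
      · -- `S` not CM: swap the factors
        have h := mtRank_hodge_one_add_one_eq_add_of_isIsogenous_prod_simpleSurfaces_of_not_isOfCMType hX hS' hS hS's hS'2 hSs hS2 hScm
          (fun h => hSS' h.symm') (hXP.trans (isIsogenous_prod_comm S S'))
        omega
    · exact mtRank_hodge_one_add_one_eq_add_of_isIsogenous_prod_simpleSurfaces_of_not_isOfCMType hX hS hS' hSs hS2 hS's hS'2 hS'cm hSS' hXP

/-- **The Mumford–Tate rank of a product of two simple abelian surfaces is one of `3, 4, 5, 6, 7, 9, 10, 11, 13, 14, 17, 21`**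
(`t(S), t(S′) ∈ {3, 4, 7, 11}`; isogenous: `t(S)`; non-isogenous: `t(S) + t(S′) − 1`). [cite: MoonenZarhin1999LowDim, Thm. (0.1) (4), §2 (2.2) and §5 (5.5)] -/
theorem mtRank_hodge_one_mem_of_isIsogenous_prod_simpleSurfaces (hX : IsSmoothProjective n X.X) {S S' : AbelianVariety ℂ}
    (hSs : S.IsSimple) (hS2 : S.dim = 2) (hS's : S'.IsSimple) (hS'2 : S'.dim = 2) (hXP : IsIsogenous X (S.prod S')) :
    haveI := BettiUniverse.finite hX 1
    (BettiUniverse.hodge exists_isReal_hodgeModel_holds hX 1).mtRank ∈ ({3, 4, 5, 6, 7, 9, 10, 11, 13, 14, 17, 21} : Set ℕ) := by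
  have hS : IsSmoothProjective S.dim S.X := AbelianVariety.isSmoothProjective_holds
  have hS' : IsSmoothProjective S'.dim S'.X := AbelianVariety.isSmoothProjective_holds
  haveI := BettiUniverse.finite hX 1
  haveI := BettiUniverse.finite hS 1
  haveI := BettiUniverse.finite hS' 1
  obtain ⟨hiso, hniso⟩ := mtRank_hodge_one_of_isIsogenous_prod_simpleSurfaces hX hS hS' hSs hS2 hS's hS'2 hXP
  simp only [Set.mem_insert_iff, Set.mem_singleton_iff]
  by_cases hSS' : IsIsogenous S S'
  · have h := hiso hSS'
    rcases mtRank_hodge_one_mem_of_isSimple_surface hS hSs hS2 with hs | hs | hs | hs <;> omega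
  · have h := hniso hSS'
    rcases mtRank_hodge_one_mem_of_isSimple_surface hS hSs hS2 with hs | hs | hs | hs <;>
      rcases mtRank_hodge_one_mem_of_isSimple_surface hS' hS's hS'2 with hs' | hs' | hs' | hs' <;> omega

end Summit.HodgeConjecture.CorCM

end
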